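/- Free-seat work of EXTRA WIDTH SEAT `ym-line-cbag-p1-w5` (prover-ym-line-cbag-p1-w5-g2-0), route `EguchiKawaiDirectionLadder`
(ideator ym-idea-2, LINE 8), crux `TripleSmallBallMargin` (stmt-QuantumFields-27724): the route-independent COUNTING ENGINE behind glue
obligation (d) `CentreSymmetricProfile` (content: planner ym-idea-2 g6's sorry-free module HOME/l8/bc/EguchiKawaiDirectionLadderPairMass.lean,
2026-08-28T12:44Z, re-homed; pure `Multiset ℂ` combinatorics, imports Mathlib only).  Nothing here bears on the Yang–Mills mass gap. -/
import Mathlib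

/-!
# Pair-mass combinatorics on the unit circle (engine of glue (d) of crux `TripleSmallBallMargin`, stmt-QuantumFields-27724)

For a multiset `Λ` of `N ≥ 1` unit complex numbers with small barycentre `‖Σ Λ‖ ≤ √δ·N`, the number of ORDERED pairs
`(z, w) ∈ Λ × Λ` at chordal distance `≤ r` is at most `((1 + δ)/2 + ε)·N²` once `r ≤ ε/(2(2K+3))` with `K ≥ 4/ε` and `ε ≤ 1/2`
(`sum_ballCount_le`).  Proof: take a maximiser `z⋆` of the `r`-neighbour count; pigeonhole over the `K` annuli
`{(2i+1)r < ‖w − z⋆‖ ≤ (2i+2)r}` gives a thin one (mass `≤ N/K`) between radii `ρ₁ = (2j+1)r` (count `B_u`) and `ρ₂ = ρ₁ + r`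
(count `B_v`); every point has at most `B_u` neighbours (maximality, `r ≤ ρ₁`), and a point outside the `ρ₂`-ball has all its
neighbours outside the `ρ₁`-ball, hence at most `N − B_u` of them; so the pair count is `≤ N·B_u` (enough when `2B_u ≤ N`) and
`≤ B_v B_u + (N − B_v)(N − B_u) = (N² + (2B_u − N)²)/2 + (B_v − B_u)(2B_u − N)`; finally the barycentre sees the big ball,
`2B_u − N − B_u ρ₁ ≤ ‖Σ Λ‖ ≤ √δ N`, whence `(2B_u − N)² ≤ (δ + 3R)N²` with `R = (2K+3)r ≤ 1/4`.  Tight at two antipodal clusters of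
masses `(1 ± √δ)/2`.  Applied to `Λ = spec U` (eigenvalues of a centre-symmetric unitary) in
`EguchiKawaiDirectionLadderTripleSmallBallMarginProfile.lean`.
-/

set_option autoImplicit false

noncomputable section

open scoped Classical

namespace Summit.QuantumFields.YangMills.Theorems.EguchiKawaiDirectionLadder

/-! ### Pair-mass combinatorics on the circle: the engine of (d)

Throughout, the `ρ`-NEIGHBOUR COUNT of `z` in `Λ` is `Multiset.card (Λ.filter fun w => ‖z - w‖ ≤ ρ)` (points with multiplicity
within chordal distance `ρ` of `z`), written out in full (no auxiliary definition). -/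

namespace PairMassCount

/-- The neighbour count is monotone in the radius. -/
theorem ballCount_mono (Λ : Multiset ℂ) {ρ ρ' : ℝ} (h : ρ ≤ ρ') (z : ℂ) :
    Multiset.card (Λ.filter fun w => ‖z - w‖ ≤ ρ) ≤ Multiset.card (Λ.filter fun w => ‖z - w‖ ≤ ρ') :=
  Multiset.card_le_card (Multiset.monotone_filter_right Λ fun w (hw : ‖z - w‖ ≤ ρ) => hw.trans h)

/-- The neighbour count is at most the total number of points. -/
theorem ballCount_le_card (Λ : Multiset ℂ) (ρ : ℝ) (z : ℂ) : Multiset.card (Λ.filter fun w => ‖z - w‖ ≤ ρ) ≤ Multiset.card Λ :=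
  Multiset.card_le_card (Multiset.filter_le _ Λ)

/-- Points inside plus points outside a ball = all points. -/
theorem ballCount_add_card_not (Λ : Multiset ℂ) (ρ : ℝ) (z : ℂ) :
    Multiset.card (Λ.filter fun w => ‖z - w‖ ≤ ρ) + Multiset.card (Λ.filter fun w => ¬ ‖z - w‖ ≤ ρ) = Multiset.card Λ := by
  rw [← Multiset.card_add, Multiset.filter_add_not]

/-- A point at distance `> ρ₁ + r` from `zs` has all its `r`-neighbours outside the `ρ₁`-ball of `zs`. -/
theorem ballCount_le_card_not (Λ : Multiset ℂ) {r ρ₁ : ℝ} {zs z : ℂ} (hz : ρ₁ + r < ‖zs - z‖) :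
    Multiset.card (Λ.filter fun w => ‖z - w‖ ≤ r) ≤ Multiset.card (Λ.filter fun w => ¬ ‖zs - w‖ ≤ ρ₁) := by
  refine Multiset.card_le_card (Multiset.monotone_filter_right Λ fun w (hw : ‖z - w‖ ≤ r) => ?_)
  intro hcontra
  have htri : ‖zs - z‖ ≤ ‖zs - w‖ + ‖z - w‖ := by
    calc ‖zs - z‖ = ‖(zs - w) + (w - z)‖ := by rw [sub_add_sub_cancel]
      _ ≤ ‖zs - w‖ + ‖w - z‖ := norm_add_le _ _
      _ = ‖zs - w‖ + ‖z - w‖ := by rw [norm_sub_rev w z]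
  linarith

/-- `‖a‖ - ‖b‖ ≤ ‖a + b‖`. -/
theorem norm_sub_norm_le_norm_add (a b : ℂ) : ‖a‖ - ‖b‖ ≤ ‖a + b‖ := by
  have h : ‖(a + b) - b‖ ≤ ‖a + b‖ + ‖b‖ := norm_sub_le _ _
  rw [add_sub_cancel_right] at h
  linarith

/-- THE CORE COUNTING BOUND (all radii explicit): for a multiset `Λ` of `N ≥ 1` unit complex
numbers with `‖Σ Λ‖ ≤ √δ·N`, resolution `r > 0`, `K ≥ 4/ε` annuli and `(2K+3)·r ≤ ε/2 ≤ 1/4`,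
the number of ordered pairs at distance `≤ r` is at most `((1+δ)/2 + ε)·N²`. -/
theorem sum_ballCount_le (Λ : Multiset ℂ) {N K : ℕ} (hN : 0 < N) (hK : 0 < K)
    (hcard : Multiset.card Λ = N) (hunit : ∀ w ∈ Λ, ‖w‖ = 1)
    {δ ε r : ℝ} (hδ : 0 ≤ δ) (hδ1 : δ ≤ 1) (hε : 0 < ε) (hr : 0 < r)
    (hKε : 4 / ε ≤ (K : ℝ)) (hR : (2 * (K : ℝ) + 3) * r ≤ ε / 2) (hε1 : ε ≤ 1 / 2)
    (htr : ‖Λ.sum‖ ≤ Real.sqrt δ * N) :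
    (Λ.map fun z => (Multiset.card (Λ.filter fun w => ‖z - w‖ ≤ r) : ℝ)).sum ≤ ((1 + δ) / 2 + ε) * (N : ℝ) ^ 2 := by
  have hNr : (0 : ℝ) < N := by exact_mod_cast hN
  have hKr : (0 : ℝ) < K := by exact_mod_cast hK
  -- maximiser of the r-neighbour count
  have hne : Λ.toFinset.Nonempty := by
    rw [Multiset.toFinset_nonempty]; intro h; rw [h, Multiset.card_zero] at hcard; omega
  obtain ⟨zs, hzs, hmax⟩ := Finset.exists_max_image Λ.toFinset (fun z => Multiset.card (Λ.filter fun w => ‖z - w‖ ≤ r)) hne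
  rw [Multiset.mem_toFinset] at hzs
  have hmax' : ∀ z ∈ Λ, Multiset.card (Λ.filter fun w => ‖z - w‖ ≤ r) ≤ Multiset.card (Λ.filter fun w => ‖zs - w‖ ≤ r) := fun z hz =>
    hmax z (Multiset.mem_toFinset.mpr hz)
  have hzs1 : ‖zs‖ = 1 := hunit zs hzs
  -- ball counts around zs
  set b : ℝ → ℕ := fun ρ => Multiset.card (Λ.filter fun w => ‖zs - w‖ ≤ ρ) with hb
  have hbmono : ∀ {ρ ρ' : ℝ}, ρ ≤ ρ' → b ρ ≤ b ρ' := fun h => ballCount_mono Λ h zs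
  have hbN : ∀ ρ, b ρ ≤ N := fun ρ => hcard ▸ ballCount_le_card Λ ρ zs
  -- pigeonhole over the K annuli {(2i+1)r < |w - zs| ≤ (2i+2)r}
  obtain ⟨j, hjK, hj⟩ : ∃ j ∈ Finset.range K,
      ((b ((2 * (j : ℝ) + 2) * r) : ℝ) - b ((2 * (j : ℝ) + 1) * r)) ≤ (N : ℝ) / K := by
    apply Finset.exists_le_of_sum_le (Finset.nonempty_range_iff.mpr hK.ne')
    have htel : ∑ i ∈ Finset.range K,
        (((b ((2 * ((i + 1 : ℕ) : ℝ) + 1) * r) : ℝ) - b ((2 * (i : ℝ) + 1) * r))) =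
        (b ((2 * ((K : ℕ) : ℝ) + 1) * r) : ℝ) - b ((2 * ((0 : ℕ) : ℝ) + 1) * r) :=
      Finset.sum_range_sub (fun i : ℕ => ((b ((2 * (i : ℝ) + 1) * r) : ℝ))) K
    have hstep : ∀ i ∈ Finset.range K,
        ((b ((2 * (i : ℝ) + 2) * r) : ℝ) - b ((2 * (i : ℝ) + 1) * r)) ≤
          (b ((2 * ((i + 1 : ℕ) : ℝ) + 1) * r) : ℝ) - b ((2 * (i : ℝ) + 1) * r) := by
      intro i _
      have hi0 : (0 : ℝ) ≤ i := by positivity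
      have : (b ((2 * (i : ℝ) + 2) * r) : ℝ) ≤ b ((2 * ((i + 1 : ℕ) : ℝ) + 1) * r) := by
        exact_mod_cast hbmono (by push_cast; exact mul_le_mul_of_nonneg_right (by linarith) hr.le)
      linarith
    calc ∑ i ∈ Finset.range K, ((b ((2 * (i : ℝ) + 2) * r) : ℝ) - b ((2 * (i : ℝ) + 1) * r))
        ≤ ∑ i ∈ Finset.range K,
            ((b ((2 * ((i + 1 : ℕ) : ℝ) + 1) * r) : ℝ) - b ((2 * (i : ℝ) + 1) * r)) :=
          Finset.sum_le_sum hstep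
      _ = (b ((2 * ((K : ℕ) : ℝ) + 1) * r) : ℝ) - b ((2 * ((0 : ℕ) : ℝ) + 1) * r) := htel
      _ ≤ (N : ℝ) := by
          have h1 : ((b ((2 * ((K : ℕ) : ℝ) + 1) * r) : ℕ) : ℝ) ≤ N := by exact_mod_cast hbN _
          have h2 : (0 : ℝ) ≤ ((b ((2 * ((0 : ℕ) : ℝ) + 1) * r) : ℕ) : ℝ) := by positivity
          linarith
      _ = ∑ _i ∈ Finset.range K, ((N : ℝ) / K) := by
          rw [Finset.sum_const, Finset.card_range, nsmul_eq_mul]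
          field_simp
  have hj0 : (0 : ℝ) ≤ j := by positivity
  have hjK' : (j : ℝ) + 1 ≤ K := by
    have := Finset.mem_range.mp hjK
    exact_mod_cast Nat.succ_le_of_lt this
  -- the two radii ρ₁ = (2j+1) r (count Bu) and ρ₂ = ρ₁ + r = (2j+2) r (count Bv)
  set ρ₁ : ℝ := (2 * (j : ℝ) + 1) * r with hρ₁
  set ρ₂ : ℝ := (2 * (j : ℝ) + 2) * r with hρ₂
  have hρ12 : ρ₁ + r = ρ₂ := by simp only [hρ₁, hρ₂]; ring
  have hρ₁0 : 0 ≤ ρ₁ := by rw [hρ₁]; positivity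
  set Bu : ℕ := b ρ₁ with hBu
  set Bv : ℕ := b ρ₂ with hBv
  have hM_Bu : Multiset.card (Λ.filter fun w => ‖zs - w‖ ≤ r) ≤ Bu := hbmono (by rw [hρ₁]; exact le_mul_of_one_le_left hr.le (by linarith))
  have hBuN : Bu ≤ N := hbN _
  have hBvN : Bv ≤ N := hbN _
  have hBur : (Bu : ℝ) ≤ N := by exact_mod_cast hBuN
  have hBvr : (Bv : ℝ) ≤ N := by exact_mod_cast hBvN
  have hBu0 : (0 : ℝ) ≤ Bu := by positivity
  have hthin : (Bv : ℝ) - Bu ≤ N / K := hj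
  -- complement cardinalities
  have hcompl : ∀ ρ : ℝ, (Multiset.card (Λ.filter fun w => ¬ ‖zs - w‖ ≤ ρ) : ℝ) = N - b ρ := by
    intro ρ
    have h := ballCount_add_card_not Λ ρ zs
    rw [hcard] at h
    have h' : ((b ρ : ℕ) : ℝ) + (Multiset.card (Λ.filter fun w => ¬ ‖zs - w‖ ≤ ρ) : ℝ) = N := by
      exact_mod_cast h
    linarith
  -- split of the pair sum by the predicate ‖zs - z‖ ≤ ρ₂
  have hsplit : (Λ.map fun z => (Multiset.card (Λ.filter fun w => ‖z - w‖ ≤ r) : ℝ)).sum =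
      ((Λ.filter fun z => ‖zs - z‖ ≤ ρ₂).map fun z => (Multiset.card (Λ.filter fun w => ‖z - w‖ ≤ r) : ℝ)).sum +
      ((Λ.filter fun z => ¬ ‖zs - z‖ ≤ ρ₂).map fun z => (Multiset.card (Λ.filter fun w => ‖z - w‖ ≤ r) : ℝ)).sum := by
    rw [← Multiset.sum_add, ← Multiset.map_add, Multiset.filter_add_not]
  have hin_card : Multiset.card (Λ.filter fun z => ‖zs - z‖ ≤ ρ₂) = Bv := rfl
  -- inner sum ≤ Bv * Bu (every count ≤ the maximal one ≤ Bu)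
  have hin : ((Λ.filter fun z => ‖zs - z‖ ≤ ρ₂).map fun z => (Multiset.card (Λ.filter fun w => ‖z - w‖ ≤ r) : ℝ)).sum ≤
      (Bv : ℝ) * Bu := by
    have h := Multiset.sum_le_card_nsmul
      ((Λ.filter fun z => ‖zs - z‖ ≤ ρ₂).map fun z => (Multiset.card (Λ.filter fun w => ‖z - w‖ ≤ r) : ℝ)) (Bu : ℝ) ?_
    · rw [Multiset.card_map, hin_card, nsmul_eq_mul] at h; exact h
    · intro x hx
      obtain ⟨z, hz, rfl⟩ := Multiset.mem_map.mp hx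
      have hzΛ : z ∈ Λ := (Multiset.mem_filter.mp hz).1
      exact_mod_cast (hmax' z hzΛ).trans hM_Bu
  -- outer sum ≤ (N - Bv) * Bu
  have hout1 : ((Λ.filter fun z => ¬ ‖zs - z‖ ≤ ρ₂).map fun z => (Multiset.card (Λ.filter fun w => ‖z - w‖ ≤ r) : ℝ)).sum ≤
      ((N : ℝ) - Bv) * Bu := by
    have h := Multiset.sum_le_card_nsmul
      ((Λ.filter fun z => ¬ ‖zs - z‖ ≤ ρ₂).map fun z => (Multiset.card (Λ.filter fun w => ‖z - w‖ ≤ r) : ℝ)) (Bu : ℝ) ?_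
    · rw [Multiset.card_map, nsmul_eq_mul, hcompl ρ₂] at h; exact h
    · intro x hx
      obtain ⟨z, hz, rfl⟩ := Multiset.mem_map.mp hx
      have hzΛ : z ∈ Λ := (Multiset.mem_filter.mp hz).1
      exact_mod_cast (hmax' z hzΛ).trans hM_Bu
  -- outer sum ≤ (N - Bv) * (N - Bu): outer points see only the complement of the ρ₁-ball
  have hout2 : ((Λ.filter fun z => ¬ ‖zs - z‖ ≤ ρ₂).map fun z => (Multiset.card (Λ.filter fun w => ‖z - w‖ ≤ r) : ℝ)).sum ≤
      ((N : ℝ) - Bv) * ((N : ℝ) - Bu) := by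
    have h := Multiset.sum_le_card_nsmul
      ((Λ.filter fun z => ¬ ‖zs - z‖ ≤ ρ₂).map fun z => (Multiset.card (Λ.filter fun w => ‖z - w‖ ≤ r) : ℝ)) ((N : ℝ) - Bu) ?_
    · rw [Multiset.card_map, nsmul_eq_mul, hcompl ρ₂] at h; exact h
    · intro x hx
      obtain ⟨z, hz, rfl⟩ := Multiset.mem_map.mp hx
      have hzP : ¬ ‖zs - z‖ ≤ ρ₂ := (Multiset.mem_filter.mp hz).2
      have hlt : ρ₁ + r < ‖zs - z‖ := by rw [hρ12]; exact lt_of_not_ge hzP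
      have h1 := ballCount_le_card_not Λ hlt
      have h2 := hcompl ρ₁
      have h1' : (Multiset.card (Λ.filter fun w => ‖z - w‖ ≤ r) : ℝ) ≤ (Multiset.card (Λ.filter fun w => ¬ ‖zs - w‖ ≤ ρ₁) : ℝ) := by
        exact_mod_cast h1
      linarith
  -- the trace sees the big ball: 2 Bu - N ≤ √δ N + Bu ρ₁
  have htr2 : 2 * (Bu : ℝ) - N ≤ Real.sqrt δ * N + Bu * ρ₁ := by
    have hs : Λ.sum = (Λ.filter fun w => ‖zs - w‖ ≤ ρ₁).sum +
        (Λ.filter fun w => ¬ ‖zs - w‖ ≤ ρ₁).sum := by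
      rw [← Multiset.sum_add, Multiset.filter_add_not]
    have hcardQ : Multiset.card (Λ.filter fun w => ‖zs - w‖ ≤ ρ₁) = Bu := rfl
    -- inner sum = Bu • zs + deviations
    have hinner : (Λ.filter fun w => ‖zs - w‖ ≤ ρ₁).sum =
        (Bu : ℂ) * zs + ((Λ.filter fun w => ‖zs - w‖ ≤ ρ₁).map fun w => w - zs).sum := by
      have h1 : (Λ.filter fun w => ‖zs - w‖ ≤ ρ₁) =
          (Λ.filter fun w => ‖zs - w‖ ≤ ρ₁).map (fun w => zs + (w - zs)) := by
        conv_lhs => rw [← Multiset.map_id (Λ.filter fun w => ‖zs - w‖ ≤ ρ₁)]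
        exact Multiset.map_congr rfl (fun w _ => by simp)
      conv_lhs => rw [h1]
      rw [Multiset.sum_map_add, Multiset.map_const', Multiset.sum_replicate, hcardQ, nsmul_eq_mul]
    have hdev : ‖((Λ.filter fun w => ‖zs - w‖ ≤ ρ₁).map fun w => w - zs).sum‖ ≤ (Bu : ℝ) * ρ₁ := by
      calc ‖((Λ.filter fun w => ‖zs - w‖ ≤ ρ₁).map fun w => w - zs).sum‖
          ≤ (((Λ.filter fun w => ‖zs - w‖ ≤ ρ₁).map fun w => w - zs).map fun x => ‖x‖).sum :=
            norm_multiset_sum_le _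
        _ ≤ Multiset.card (((Λ.filter fun w => ‖zs - w‖ ≤ ρ₁).map fun w => w - zs).map
              fun x => ‖x‖) • ρ₁ := by
            apply Multiset.sum_le_card_nsmul
            intro x hx
            obtain ⟨y, hy, rfl⟩ := Multiset.mem_map.mp hx
            obtain ⟨w, hw, rfl⟩ := Multiset.mem_map.mp hy
            have hwρ : ‖zs - w‖ ≤ ρ₁ := (Multiset.mem_filter.mp hw).2
            rwa [norm_sub_rev]
        _ = (Bu : ℝ) * ρ₁ := by rw [Multiset.card_map, Multiset.card_map, hcardQ, nsmul_eq_mul]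
    have houter : ‖(Λ.filter fun w => ¬ ‖zs - w‖ ≤ ρ₁).sum‖ ≤ (N : ℝ) - Bu := by
      calc ‖(Λ.filter fun w => ¬ ‖zs - w‖ ≤ ρ₁).sum‖
          ≤ ((Λ.filter fun w => ¬ ‖zs - w‖ ≤ ρ₁).map fun x => ‖x‖).sum := norm_multiset_sum_le _
        _ ≤ Multiset.card ((Λ.filter fun w => ¬ ‖zs - w‖ ≤ ρ₁).map fun x => ‖x‖) • (1 : ℝ) := by
            apply Multiset.sum_le_card_nsmul
            intro x hx
            obtain ⟨w, hw, rfl⟩ := Multiset.mem_map.mp hx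
            exact (hunit w (Multiset.mem_filter.mp hw).1).le
        _ = (N : ℝ) - Bu := by rw [Multiset.card_map, nsmul_eq_mul, mul_one, hcompl ρ₁]
    have hBuzs : ‖(Bu : ℂ) * zs‖ = Bu := by
      rw [norm_mul, hzs1, mul_one, Complex.norm_natCast]
    have hin_lb : (Bu : ℝ) - Bu * ρ₁ ≤ ‖(Λ.filter fun w => ‖zs - w‖ ≤ ρ₁).sum‖ := by
      rw [hinner]
      have := norm_sub_norm_le_norm_add ((Bu : ℂ) * zs)
        (((Λ.filter fun w => ‖zs - w‖ ≤ ρ₁).map fun w => w - zs).sum)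
      linarith
    have htot : ((Bu : ℝ) - Bu * ρ₁) - ((N : ℝ) - Bu) ≤ ‖Λ.sum‖ := by
      rw [hs]
      have := norm_sub_norm_le_norm_add ((Λ.filter fun w => ‖zs - w‖ ≤ ρ₁).sum)
        ((Λ.filter fun w => ¬ ‖zs - w‖ ≤ ρ₁).sum)
      linarith
    linarith
  -- constants
  set R : ℝ := (2 * (K : ℝ) + 3) * r with hRdef
  have hR0 : 0 ≤ R := by positivity
  have hRq : R ≤ 1 / 4 := by linarith
  have hρ₁R : ρ₁ ≤ R := by
    rw [hρ₁, hRdef]; exact mul_le_mul_of_nonneg_right (by linarith) hr.le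
  have hK4 : 1 / (K : ℝ) ≤ ε / 4 := by
    rw [one_div_le hKr (by positivity), one_div_div]
    exact hKε
  have hsq1 : Real.sqrt δ ≤ 1 := by
    rw [show (1 : ℝ) = Real.sqrt 1 from Real.sqrt_one.symm]
    exact Real.sqrt_le_sqrt hδ1
  have hsq0 : 0 ≤ Real.sqrt δ := Real.sqrt_nonneg δ
  have hsqsq : Real.sqrt δ ^ 2 = δ := Real.sq_sqrt hδ
  have hN2 : (0 : ℝ) ≤ (N : ℝ) ^ 2 := by positivity
  -- case analysis on the mass of the ρ₁-ball
  by_cases hcase : 2 * (Bu : ℝ) ≤ N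
  · -- Case A: every count ≤ Bu ≤ N/2
    have hS : (Λ.map fun z => (Multiset.card (Λ.filter fun w => ‖z - w‖ ≤ r) : ℝ)).sum ≤ (N : ℝ) * Bu := by
      have hidA : (Bv : ℝ) * Bu + ((N : ℝ) - Bv) * Bu = (N : ℝ) * Bu := by ring
      rw [hsplit]; linarith [hin, hout1]
    have hNBu : (N : ℝ) * Bu ≤ (N : ℝ) * (N / 2) := mul_le_mul_of_nonneg_left (by linarith) hNr.le
    calc (Λ.map fun z => (Multiset.card (Λ.filter fun w => ‖z - w‖ ≤ r) : ℝ)).sum ≤ (N : ℝ) * Bu := hS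
      _ ≤ (N : ℝ) * (N / 2) := hNBu
      _ = (1 / 2) * (N : ℝ) ^ 2 := by ring
      _ ≤ ((1 + δ) / 2 + ε) * (N : ℝ) ^ 2 := mul_le_mul_of_nonneg_right (by linarith) hN2
  · -- Case B: the ρ₁-ball is heavy; use the thin annulus and the trace
    push Not at hcase
    have hpos : 0 ≤ 2 * (Bu : ℝ) - N := by linarith
    have hSB : (Λ.map fun z => (Multiset.card (Λ.filter fun w => ‖z - w‖ ≤ r) : ℝ)).sum ≤
        (Bv : ℝ) * Bu + ((N : ℝ) - Bv) * ((N : ℝ) - Bu) := by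
      rw [hsplit]; linarith [hin, hout2]
    have hid : (Bv : ℝ) * Bu + ((N : ℝ) - Bv) * ((N : ℝ) - Bu) =
        ((N : ℝ) ^ 2 + (2 * Bu - N) ^ 2) / 2 + ((Bv : ℝ) - Bu) * (2 * Bu - N) := by ring
    have hthin' : ((Bv : ℝ) - Bu) * (2 * Bu - N) ≤ ((N : ℝ) / K) * N :=
      mul_le_mul hthin (by linarith) hpos (by positivity)
    have hx : 2 * (Bu : ℝ) - N ≤ (Real.sqrt δ + R) * N := by
      have h1 : (Bu : ℝ) * ρ₁ ≤ N * R := mul_le_mul hBur hρ₁R hρ₁0 hNr.le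
      have h2 : (Real.sqrt δ + R) * N = Real.sqrt δ * N + N * R := by ring
      linarith [htr2, h1, h2]
    have hsq : (2 * (Bu : ℝ) - N) ^ 2 ≤ (δ + 3 * R) * (N : ℝ) ^ 2 := by
      have h1 : (2 * (Bu : ℝ) - N) ^ 2 ≤ ((Real.sqrt δ + R) * N) ^ 2 := pow_le_pow_left₀ hpos hx 2
      have h2 : (Real.sqrt δ + R) ^ 2 ≤ δ + 3 * R := by
        have e1 : R * Real.sqrt δ ≤ R := mul_le_of_le_one_right hR0 hsq1
        have e2 : R ^ 2 ≤ R := pow_le_of_le_one hR0 (by linarith) two_ne_zero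
        calc (Real.sqrt δ + R) ^ 2 = Real.sqrt δ ^ 2 + 2 * (R * Real.sqrt δ) + R ^ 2 := by ring
          _ ≤ δ + 2 * R + R := by rw [hsqsq]; linarith
          _ = δ + 3 * R := by ring
      calc (2 * (Bu : ℝ) - N) ^ 2 ≤ ((Real.sqrt δ + R) * N) ^ 2 := h1
        _ = (Real.sqrt δ + R) ^ 2 * (N : ℝ) ^ 2 := by ring
        _ ≤ (δ + 3 * R) * (N : ℝ) ^ 2 := mul_le_mul_of_nonneg_right h2 hN2
    have hK4' : ((N : ℝ) / K) * N ≤ (ε / 4) * (N : ℝ) ^ 2 := by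
      have : ((N : ℝ) / K) * N = (1 / K) * (N : ℝ) ^ 2 := by ring
      rw [this]; exact mul_le_mul_of_nonneg_right hK4 hN2
    calc (Λ.map fun z => (Multiset.card (Λ.filter fun w => ‖z - w‖ ≤ r) : ℝ)).sum
        ≤ (Bv : ℝ) * Bu + ((N : ℝ) - Bv) * ((N : ℝ) - Bu) := hSB
      _ = ((N : ℝ) ^ 2 + (2 * Bu - N) ^ 2) / 2 + ((Bv : ℝ) - Bu) * (2 * Bu - N) := hid
      _ ≤ ((N : ℝ) ^ 2 + (δ + 3 * R) * (N : ℝ) ^ 2) / 2 + (ε / 4) * (N : ℝ) ^ 2 := by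
          linarith [hsq, hthin', hK4']
      _ = ((1 + δ + 3 * R) / 2 + ε / 4) * (N : ℝ) ^ 2 := by ring
      _ ≤ ((1 + δ) / 2 + ε) * (N : ℝ) ^ 2 := mul_le_mul_of_nonneg_right (by linarith) hN2

end PairMassCount

end Summit.QuantumFields.YangMills.Theorems.EguchiKawaiDirectionLadder

end
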